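import Literature.Topology.FourManifolds.SurfaceGroupNielsenCoreSides
import Literature.Topology.FourManifolds.SurfaceGroupNielsenCoreSeparation2
import Literature.Topology.FourManifolds.SurfaceGroupNielsenCoreNoDoublePoint
import Literature.GroupTheory.CombinatorialGroupTheory.BinaryProductParity
import HarnessLib

/-!
# Nielsen's theorem, pillar CORE: a double point at two junctions (case J-J)

Topic `Literature/Topology/FourManifolds`.  The case of the case analysis of a double point
`a < b` on the closed path `C` of a potential-minimal configuration (Zieschang–Vogt–Coldewey,
LNM 835, proof of Thm. 5.3.2 with Lemma 5.3.4, in the lead's minimal-counterexample recasting)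
in which BOTH cuts are junctions: `a = Kstart k₂` and `b = Kstart k₄` are the start positions of
two kernels (`k₂ < k₄ < m`), with the (possibly empty) cancelled spurs of lengths
`c_a = jc (k₂ - 1)` and `c_b = jc (k₄ - 1)` hanging at the common vertex `v = P_a = P_b`.
There is no portal occurrence, so the inside occurrences are exactly `k₂ ≤ j < k₄` and, by
Claim (A), they form a symbol-closed block.

* **Crossing edges.**  No formal edge crosses the fixation (Claim (A)); a cancelling edge crosses
  iff it lies in the spur of one of the two cut junctions, i.e. the crossing edges are the
  cancelling edges `α_e` at the head slots `(k₂, e)`, `e < c_a`, and `β_e` at the head slots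
  `(k₄, e)`, `e < c_b`, of level `e`.
* **Parity.**  A lone crossing edge at a level is impossible, so `c_a = c_b =: c`; and for
  `e < c` the two crossing edges `α_e`, `β_e` lie on one component of the partner graph, whence
  the two head slots `(k₂, e)`, `(k₄, e)` (both of type `Y`) carry the same letter:
  `head k₂ = head k₄` (equivalently, the two spur words `tail (k₂ - 1)`, `tail (k₄ - 1)`
  coincide).
* **Vertices.**  The kernel of occurrence `j` starts at `E_j · head j`; with `absv a = absv b`
  this gives `E_{k₂} = E_{k₄}`: the inside block `k₂, …, k₄ - 1` (non-empty, proper,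
  symbol-closed) has trivial value — a decomposition, contradicting indecomposability
  (`false_of_occStart_eq`).

## References

* H. Zieschang, E. Vogt, H.-D. Coldewey, *Surfaces and Planar Discontinuous Groups*, LNM 835
  (1980), proof of Thm. 5.3.2 and Lemma 5.3.4. [ZieschangVogtColdewey1980]
-/

noncomputable section

namespace Literature.Topology.FourManifolds

open Literature.GroupTheory.CombinatorialGroupTheory CycFactors List

namespace SurfaceGroup

namespace Config

variable {g : ℕ} {φ : surfaceGen g → SurfaceGroup g}

section JJ

variable (hg : 2 ≤ g) (hK : RelatorKilled φ) (hI : Indecomposable φ) (hM : MarkedNontrivial φ)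
  (κ : Config φ) (hmin : κ.IsMin) (d : κ.DoublePoint)
include hg hK hI hM hmin

omit hK in
/-- **No double point at two junctions** (case J-J of the fixation of a double point).
[cite: ZieschangVogtColdewey1980, proof of Thm. 5.3.2 and Lemma 5.3.4] -/
theorem false_of_doublePoint_JJ (hJa : κ.IsJunction d.a) (hJb : κ.IsJunction d.b) : False := by
  have hg1 : 1 ≤ g := by omega
  let _i : Inhabited (surfaceGen g) := ⟨(⟨0, hg1⟩, false)⟩
  have hN := κ.cycNielsen_U hg1 hI hM hmin
  have hU := κ.U_ne_nil hg1
  have hbar := κ.isPairing_bar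
  have hab := d.lt
  have hbℓ := d.lt_length
  -- no occurrence is a portal
  have hnpa : ∀ j, ¬ κ.PortalAt d.a j := κ.not_portalAt_of_isJunction hJa
  have hnpb : ∀ j, ¬ κ.PortalAt d.b j := κ.not_portalAt_of_isJunction hJb
  have hsep : ∀ j, ¬ (κ.PortalAt d.a j ∧ κ.PortalAt d.b j) := fun j h => hnpa j h.1
  -- the two cut junctions `k₂ < k₄ < m`
  obtain ⟨k₂, hk₂, hk₂a⟩ := hJa
  obtain ⟨k₄, hk₄, hk₄b⟩ := hJb
  have h24 : k₂ < k₄ :=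
    (κ.Kstart_lt_Kstart_iff hg1 hI hM hmin).1 (by rw [hk₂a, hk₄b]; exact hab)
  have hk₂U : k₂ < κ.U.length := by rw [length_U]; exact hk₂
  have hk₄U : k₄ < κ.U.length := by rw [length_U]; exact hk₄
  -- (P2): the two ends of every chain lie on the same side
  have hP2 := DoublePoint.kpos_mem_iff_of_chainEnd κ hg1 hI hM hmin d
  -- the side function of the fixation
  let s : ℕ × ℕ → Bool := fun σ => decide (κ.SideIn d.a d.b σ)
  have hP2s : ∀ τ, IsKernelSlot κ.U τ → s τ = s (chainEnd κ.U κ.bar τ) := fun τ hτ =>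
    κ.decide_sideIn_eq_decide_sideIn_chainEnd hg1 hI hM hmin hab hsep hP2 hτ
  -- the head slots of the two cut junctions (the spurs)
  set ca := jc κ.U (cpred κ.U k₂) with hca
  set cb := jc κ.U (cpred κ.U k₄) with hcb
  have hhead₂ : ∀ e, e < ca → IsHeadSlot κ.U (k₂, e) := fun e he =>
    ⟨⟨hk₂U, lt_of_lt_of_le he (jc_cpred_le_length κ.U k₂)⟩, he⟩
  have hhead₄ : ∀ e, e < cb → IsHeadSlot κ.U (k₄, e) := fun e he =>
    ⟨⟨hk₄U, lt_of_lt_of_le he (jc_cpred_le_length κ.U k₄)⟩, he⟩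
  -- CROSSING CANCELLING EDGES: the cancelling edge at a head slot crosses iff the slot belongs
  -- to `k₂` or to `k₄`
  have hcrossH : ∀ σ : ℕ × ℕ, IsHeadSlot κ.U σ →
      (IsCrossing s (cedge κ.U σ) ↔ (σ.1 = k₂ ∨ σ.1 = k₄)) := by
    intro σ hσ
    have hkσ : ¬ IsKernelSlot κ.U σ := fun hk => hk.not_isHeadSlot hσ
    have e1 : IsCrossing s (cedge κ.U σ) ↔ κ.CCross d.a d.b σ :=
      isCrossing_cedge.trans (κ.ccross_iff_decide_ne hσ.1 hkσ).symm
    rw [e1, κ.ccross_iff_of_isHeadSlot hg1 hI hM hmin hab hbℓ hsep hσ]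
    constructor
    · rintro (h | h)
      · exact Or.inl (κ.Kstart_injective hg1 hI hM hmin (h.trans hk₂a.symm))
      · exact Or.inr (κ.Kstart_injective hg1 hI hM hmin (h.trans hk₄b.symm))
    · rintro (h | h)
      · exact Or.inl (by rw [h, hk₂a])
      · exact Or.inr (by rw [h, hk₄b])
  have hαcross : ∀ e, e < ca → IsCrossing s (cedge κ.U (k₂, e)) := fun e he =>
    (hcrossH _ (hhead₂ e he)).2 (Or.inl rfl)
  have hβcross : ∀ e, e < cb → IsCrossing s (cedge κ.U (k₄, e)) := fun e he =>
    (hcrossH _ (hhead₄ e he)).2 (Or.inr rfl)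
  -- ENUMERATION: every crossing edge all of whose ends have level `e` is `α_e` (and `e < c_a`)
  -- or `β_e` (and `e < c_b`)
  have key : ∀ (τ : ℕ × ℕ) (e : ℕ), IsHeadSlot κ.U τ → IsCrossing s (cedge κ.U τ) →
      level κ.U τ = e → (τ = (k₂, e) ∧ e < ca) ∨ (τ = (k₄, e) ∧ e < cb) := by
    intro τ e hτ hcτ hl
    rw [hτ.level_eq hN] at hl
    have h2 := hτ.2
    rcases (hcrossH τ hτ).1 hcτ with h1 | h1
    · refine Or.inl ⟨Prod.ext h1 hl, ?_⟩
      rw [← hl, hca, ← h1]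
      exact h2
    · refine Or.inr ⟨Prod.ext h1 hl, ?_⟩
      rw [← hl, hcb, ← h1]
      exact h2
  have hall : ∀ ε', IsEdge κ.U κ.bar ε' → IsCrossing s ε' → ∀ e, (∀ ρ' ∈ ε'.2, level κ.U ρ' = e) →
      (ε' = cedge κ.U (k₂, e) ∧ e < ca) ∨ (ε' = cedge κ.U (k₄, e) ∧ e < cb) := by
    intro ε' hε' hc' e hlev
    obtain ⟨σ', hσ', h' | ⟨hkσ', h'⟩⟩ := hε'
    · -- a formal edge never crosses (Claim (A): there is no portal)
      subst h'
      exfalso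
      have hfc : κ.FCross d.a d.b σ' := (κ.fcross_iff_decide_ne _ _ _).2 (isCrossing_fedge.1 hc')
      exact κ.not_fcross_of_not_portalAt hg1 hI hM hmin hP2 hσ' (hnpa _) (hnpb _) (hnpa _)
        (hnpb _) hfc
    · subst h'
      rcases hσ'.head_or_tail hkσ' with hh | ht
      · have hl := hlev σ' (mem_cedge.2 (Or.inl rfl))
        rcases key σ' e hh hc' hl with ⟨h1, h2⟩ | ⟨h1, h2⟩
        · exact Or.inl ⟨by rw [h1], h2⟩
        · exact Or.inr ⟨by rw [h1], h2⟩
      · -- a tail slot: read the edge from its cancelling partner, a head slot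
        have hh := ht.isHeadSlot_cget
        have e1 : cedge κ.U (cget κ.U σ') = cedge κ.U σ' := cedge_cget hN hU hσ' hkσ'
        have hl := hlev (cget κ.U σ') (mem_cedge.2 (Or.inr rfl))
        have hc'' : IsCrossing s (cedge κ.U (cget κ.U σ')) := by rw [e1]; exact hc'
        rcases key _ e hh hc'' hl with ⟨h1, h2⟩ | ⟨h1, h2⟩
        · exact Or.inl ⟨by rw [← e1, h1], h2⟩
        · exact Or.inr ⟨by rw [← e1, h1], h2⟩
  -- PARITY 1: the two spurs have the same length (a lone crossing edge at a level is impossible)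
  have hcacb : ca = cb := by
    rcases lt_trichotomy ca cb with hlt | heq | hlt
    · exfalso
      have hh := hhead₄ ca hlt
      refine false_of_crossing_alone_level hN hU hbar hP2s
        (isEdge_cedge hh.1 (fun hk => hk.not_isHeadSlot hh)) (hβcross ca hlt)
        ⟨(k₄, ca), mem_cedge.2 (Or.inl rfl), hh.level_eq hN⟩ fun ε' hε' hc' hlev => ?_
      rcases hall ε' hε' hc' ca hlev with ⟨-, h2⟩ | ⟨h1, -⟩
      · exact absurd h2 (lt_irrefl _)
      · exact h1
    · exact heq
    · exfalso
      have hh := hhead₂ cb hlt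
      refine false_of_crossing_alone_level hN hU hbar hP2s
        (isEdge_cedge hh.1 (fun hk => hk.not_isHeadSlot hh)) (hαcross cb hlt)
        ⟨(k₂, cb), mem_cedge.2 (Or.inl rfl), hh.level_eq hN⟩ fun ε' hε' hc' hlev => ?_
      rcases hall ε' hε' hc' cb hlev with ⟨h1, -⟩ | ⟨-, h2⟩
      · exact h1
      · exact absurd h2 (lt_irrefl _)
  -- PARITY 2: for `e < c` the edges `α_e`, `β_e` lie on one component
  have hsame : ∀ e, e < ca → SameComp κ.U κ.bar (k₂, e) (k₄, e) := by
    intro e he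
    have hh := hhead₂ e he
    refine sameComp_of_crossing_pair_level hN hU hbar hP2s (ε₂ := cedge κ.U (k₄, e))
      (isEdge_cedge hh.1 (fun hk => hk.not_isHeadSlot hh)) (hαcross e he)
      ⟨(k₂, e), mem_cedge.2 (Or.inl rfl), hh.level_eq hN⟩ (fun ε' hε' hc' hlev => ?_)
      (k₂, e) (mem_cedge.2 (Or.inl rfl)) (k₄, e) (mem_cedge.2 (Or.inl rfl))
    rcases hall ε' hε' hc' e hlev with ⟨h1, -⟩ | ⟨h1, -⟩
    · exact Or.inl h1
    · exact Or.inr h1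
  -- LETTERS: the two heads coincide (head slots have type `Y`)
  have hheads : CycFactors.head κ.U k₂ = CycFactors.head κ.U k₄ := by
    refine List.ext_getElem ?_ fun i h1 h2 => ?_
    · rw [CycFactors.length_head, CycFactors.length_head]
      exact hcacb
    · have h1' : i < ca := lt_of_lt_of_eq h1 (CycFactors.length_head _ _)
      have h2' : i < cb := lt_of_lt_of_eq h2 (CycFactors.length_head _ _)
      have hh₂ := hhead₂ i h1'
      have hh₄ := hhead₄ i h2'
      have hl := (hsame i h1').slotLetter_eq_of_slotType_eq hN hU hbar
        (by rw [hh₂.slotType_eq hN hU, hh₄.slotType_eq hN hU])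
      rw [hh₄.1.slotLetter_eq, hh₂.1.slotLetter_eq] at hl
      simp only [CycFactors.head, List.getElem_take]
      exact hl.symm
  -- VERTICES: `E_{k₂} = E_{k₄}`
  have hvab : κ.absv d.a = κ.absv d.b := (κ.absv_eq_absv_iff _ _).2 d.pv_eq
  have hocc : κ.occStart k₂ = κ.occStart k₄ := by
    rw [κ.occStart_eq_absv_Kstart_mul hN hk₂.le, κ.occStart_eq_absv_Kstart_mul hN hk₄.le, hk₂a,
      hk₄b, hvab, hheads]
  -- the inside block `k₂, …, k₄ - 1` is symbol-closed (Claim (A)), non-empty and proper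
  refine false_of_occStart_eq hI κ h24 hk₄.le (by omega)
    (κ.blockClosed_of_bar fun j hj h1 h2 => ?_) hocc
  have hin : κ.Inside d.a d.b j := (κ.inside_iff_of_Kstart_eq hg1 hI hM hmin hk₂a hk₄b).2 ⟨h1, h2⟩
  have hin' := (κ.inside_iff_inside_bar hg1 hI hM hmin hP2 hj (hnpa _) (hnpb _) (hnpa _)
    (hnpb _)).1 hin
  exact (κ.inside_iff_of_Kstart_eq hg1 hI hM hmin hk₂a hk₄b).1 hin'

end JJ

end Config

end SurfaceGroup

end Literature.Topology.FourManifolds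

end
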